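import Summits.KontsevichZagierPeriods.Zeta5Search.LaiSweepShard

/-!
# `κ₃` sweep certificate — shard file 075 of 127 (shards 525–531 of 889)

HONEST FRAMING. Systematic search; no irrationality claim unless certified. This file only checks,
by `decide +kernel`, shards 525–531 of the order-cell sweep of the `κ₃` point `(74, 2180, 444; δ74)`
(engine `LaiSweepEngine`, soundness `LaiSweepJump/Free/Eval/Shard/Kappa3`; a shard is `⟨regime, n,
p, q, p', q', Lo, Up⟩`: `n` cells from `p/q` to `p'/q'` with integer rate sums in `[Lo, Up]`, `K =
128`, `D = 2^40`). It draws NO conclusion: only the capstone `LaiKappa3SweepCert`, which needs all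
127 shard files, does. Kernel cost of this file ≈ 560 cells × 0.3 s.
-/

namespace Summit.KontsevichZagierPeriods.Zeta5Search.Sweep

set_option maxHeartbeats 100000000 in
/-- Shard 525: 80 cells of regime B from `83/153` to `199/366`.
[cite: Lai2024BallRivoal, §4 Lemma 4.3] -/
theorem shard525 :
    Shard.check 128 (2^40)
      ⟨true, 80, 83, 153, 199, 366, 13916643172275, 17515675128553⟩ = true := by
  decide +kernel

set_option maxHeartbeats 100000000 in
/-- Shard 526: 80 cells of regime B from `199/366` to `200/367`.
[cite: Lai2024BallRivoal, §4 Lemma 4.3] -/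
theorem shard526 :
    Shard.check 128 (2^40)
      ⟨true, 80, 199, 366, 200, 367, 14018355479666, 17660685489231⟩ = true := by
  decide +kernel

set_option maxHeartbeats 100000000 in
/-- Shard 527: 80 cells of regime B from `200/367` to `124/227`.
[cite: Lai2024BallRivoal, §4 Lemma 4.3] -/
theorem shard527 :
    Shard.check 128 (2^40)
      ⟨true, 80, 200, 367, 124, 227, 14587141284894, 18396007280321⟩ = true := by
  decide +kernel

set_option maxHeartbeats 100000000 in
/-- Shard 528: 80 cells of regime B from `124/227` to `98/179`.
[cite: Lai2024BallRivoal, §4 Lemma 4.3] -/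
theorem shard528 :
    Shard.check 128 (2^40)
      ⟨true, 80, 124, 227, 98, 179, 13838284407928, 17468342867332⟩ = true := by
  decide +kernel

set_option maxHeartbeats 100000000 in
/-- Shard 529: 80 cells of regime B from `98/179` to `197/359`.
[cite: Lai2024BallRivoal, §4 Lemma 4.3] -/
theorem shard529 :
    Shard.check 128 (2^40)
      ⟨true, 80, 98, 179, 197, 359, 14144126398500, 17871919863523⟩ = true := by
  decide +kernel

set_option maxHeartbeats 100000000 in
/-- Shard 530: 80 cells of regime B from `197/359` to `11/20`.
[cite: Lai2024BallRivoal, §4 Lemma 4.3] -/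
theorem shard530 :
    Shard.check 128 (2^40)
      ⟨true, 80, 197, 359, 11, 20, 14052712877506, 17773823456998⟩ = true := by
  decide +kernel

set_option maxHeartbeats 100000000 in
/-- Shard 531: 80 cells of regime B from `11/20` to `156/283`.
[cite: Lai2024BallRivoal, §4 Lemma 4.3] -/
theorem shard531 :
    Shard.check 128 (2^40)
      ⟨true, 80, 11, 20, 156, 283, 13830663258009, 17510115670454⟩ = true := by
  decide +kernel

/-- The checked shards of this file, in order. [folklore] -/
def shards075 : List (CheckedShard 128 (2^40)) :=
  [⟨_, shard525⟩, ⟨_, shard526⟩, ⟨_, shard527⟩, ⟨_, shard528⟩, ⟨_, shard529⟩,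
    ⟨_, shard530⟩, ⟨_, shard531⟩]

end Summit.KontsevichZagierPeriods.Zeta5Search.Sweep
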